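import Literature.AlgebraicGeometry.HodgeTheory.BettiKunnethPieceHodgeClassActions
import Literature.AlgebraicGeometry.HodgeTheory.BettiKunnethHodgeClassesHodgeMorphisms
import HarnessLib

/-!
# Lemma 11.41, packaged: for `i + j = 2c`, `a + j = 2n` and `c ≥ n = dim Z` (`r = c − n`), the Hodge classes of the Künneth summand `Hⁱ(Y;ℚ) ⊗ Hʲ(Z;ℚ)` are in canonical bijection — `t ↦ (crossMap t ⊗ 1)_*` —
# with the morphisms of Hodge structures `Hᵃ(Z) → Hⁱ(Y)(r)`; hence `dim_ℚ Hdgᶜ(HⁱY ⊗ HʲZ) = dim_ℚ Hom_HS(HᵃZ, HⁱY(r))` and the duality `dim_ℚ Hom_HS(HⁱY, HʲZ(s)) = dim_ℚ Hom_HS(HᵃZ, HⁱY(r))`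
# (Voisin I §7.3.1 Def. 7.22, §11.3.3 Thm. 11.38–11.40, Lemma 11.41, pp. 285–287; Deligne 1971 2.1.13–2.1.14)

Family `hodge`, lane `lit-hodgefound` (Track 2 foundations library; Layers A1/A4), layer `Literature/AlgebraicGeometry/HodgeTheory`.  THEOREMS ONLY (no definition, no named fact, no instance;
D-0026 net debt `0`).  The seat's g30-#14 proved Lemma 11.41 on the carriers: the Hodge classes `t` of `Hⁱ(Y;ℚ) ⊗ Hʲ(Z;ℚ)` are exactly the classes whose action `(crossMap t ⊗ 1)_* : Hᵃ(Z;ℂ) → Hⁱ(Y;ℂ)`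
preserves rational classes and shifts Hodge types by `(c − n, c − n)` (killing the types below).  The tree passes between such carrier maps and genuine morphisms of `ℚ`-Hodge structures into the
Tate twist for NON-NEGATIVE bidegree (`HodgeModel.exists_hom_of_typeShift`, `HodgeModel.exists_carrier_of_hom`, Def. 7.22).  §1 combines the two when `c ≥ n` (`i = a + 2r`): every Hodge class
`t` of the summand yields a UNIQUE `φ_t ∈ Hom_HS(Hᵃ(Z), Hⁱ(Y)(r))` (into `((BettiUniverse.hodge hHD hY i).tateTwist r).cast _`, the twist transported to weight `a`) with `φ_t(v) ⊗ 1 =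
(crossMap t ⊗ 1)_*(v ⊗ 1)`; §2 conversely every `φ ∈ Hom_HS(Hᵃ(Z), Hⁱ(Y)(r))` is `φ_t` for a unique Hodge class `t`; §3 `t ↦ φ_t` is a ℚ-linear bijection, so **`dim_ℚ Hdgᶜ(Hⁱ(Y) ⊗ Hʲ(Z)) =
dim_ℚ Hom_HS(Hᵃ(Z), Hⁱ(Y)(r))`**, and with the tree's `finrank_hodgeClasses_tensor_hodge_eq_finrank_hom_tateTwist` (the same dimension as `dim_ℚ Hom_HS(Hⁱ(Y), Hʲ(Z)(s))`, `j − 2s = i`) the duality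
**`dim_ℚ Hom_HS(Hⁱ(Y), Hʲ(Z)(s)) = dim_ℚ Hom_HS(H^{2n−j}(Z), Hⁱ(Y)(r))`** (Poincaré duality of Hodge structures, read through the two descriptions of the Hodge classes of `Hⁱ(Y) ⊗ Hʲ(Z)`).  The
restriction `c ≥ n` is that of the tree's packaging (twists by `r : ℕ`); by the symmetry `Y ↔ Z` and `c ↦ m + n − c` it covers the pieces up to swapping the factors.

WHAT IS PROVED.
* §1 **`BettiUniverse.exists_hom_tateTwist_of_mem_hodgeClasses_kunnethSummand`**, **`BettiUniverse.existsUnique_hom_tateTwist_of_mem_hodgeClasses_kunnethSummand`**.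
* §2 **`BettiUniverse.exists_mem_hodgeClasses_corrAction_crossMap_eq_ofRatClass_hom`**, **`BettiUniverse.existsUnique_mem_hodgeClasses_corrAction_crossMap_eq_ofRatClass_hom`**.
* §3 **`BettiUniverse.finrank_hodgeClasses_kunnethSummand_eq_finrank_hom_tateTwist_target`**, **`BettiUniverse.finrank_hom_tateTwist_eq_finrank_hom_tateTwist_swap`** (the duality).

THE PRINTS.  C. Voisin (2002) [VoisinHodgeI2002] §7.1.1; §7.3.1 Def. 7.22; §7.3.2; §11.3.3 Thm. 11.38–11.40, Lemma 11.41 and pp. 285–287.  P. Deligne (1971) [DeligneHodgeII1971] 2.1.13–2.1.14, Thm. 2.3.5.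
A. Hatcher (2002) [HatcherAT2002] §3.3 Prop. 3.38.

THE OBJECTS (all the tree's).  `corrAction complexOrientationFamily hY hZ hab`, `BettiUniverse.crossMap`, `BettiUniverse.kunnethSummand`, `BettiUniverse.hodge hHD hX k`, `HodgeStructure.Hom`, `tateTwist`, `cast`, `hodgeClasses`,
`ofRatClass`, `ofRatClassBaseChange`, `BettiUniverse.realHodgeModel`, `hodgePQ_independent_of_hodgeModel_holds`; `HodgeModel.exists_hom_of_typeShift`, `HodgeModel.exists_carrier_of_hom`, `HodgeModel.piece_tateTwist_cast`,
`BettiUniverse.finrank_hodgeClasses_tensor_hodge_eq_finrank_hom_tateTwist`; the seat's g30-#14 `…typeShift_corrAction_crossMap_of_mem_hodgeClasses`, `…exists_mem_hodgeClasses_corrAction_crossMap_eq_of_typeShift`,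
g30-#13 `BettiUniverse.span_range_ofRatClass_eq_top`, g30-#2 `BettiUniverse.corrAction_crossMap_injective`, `BettiUniverse.eq_zero_of_corrAction_crossMap_eq_zero`.

DEVIATIONS / SCOPE.  Non-negative bidegree only (`c ≥ dim Z`), complex orientations.  No `LinearEquiv` is defined (theorem-only file): the bijection is recorded as two `∃!` statements and the
`finrank` identity.  No definitions.

## References
* [VoisinHodgeI2002] C. Voisin, *Hodge Theory and Complex Algebraic Geometry I* (2002) — §7.1.1; §7.3.1 Def. 7.22; §7.3.2; §11.3.3 Thm. 11.38–11.40, Lemma 11.41, pp. 285–287.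
* [DeligneHodgeII1971] P. Deligne, *Théorie de Hodge II* (1971) — 2.1.13–2.1.14, Thm. 2.3.5.
* [HatcherAT2002] A. Hatcher, *Algebraic Topology* (2002) — §3.3 Prop. 3.38.

## Provenance
Lane `lit-hodgefound` (Hodge path, Track 2), prover seat `lit-hodgefound-p29` (generation 30), self-proposed row g30-#17 (Lemma 11.41 packaged into `Hom_HS` for non-negative bidegree; g30-#14 + the
tree's `HodgeStructureOfHodgeModelTypeShift`).
-/

noncomputable section

open scoped TensorProduct
open CategoryTheory MonoidalCategory CartesianMonoidalCategory Module Finset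
open Literature.AlgebraicTopology.SingularHomology
open Literature.Geometry.Kaehler

namespace Literature.AlgebraicGeometry.HodgeTheory

open Literature.AlgebraicGeometry.Motives
open Literature.AlgebraicGeometry.Motives.HodgeStructure

variable {m n : ℕ} {Y Z : SchemeOver ℂ}

variable [HodgeTensorFacts.{0, 0}]

/-! ### §1 From a Hodge class of the summand to a morphism of Hodge structures into the Tate twist -/

/-- **A Hodge class `t` of `Hⁱ(Y;ℚ) ⊗ Hʲ(Z;ℚ)` (`i + j = 2c`, `a + j = 2n`, `c = n + r`) defines a morphism of Hodge structures `φ_t : Hᵃ(Z) → Hⁱ(Y)(r)` with `φ_t(v) ⊗ 1 = (crossMap t ⊗ 1)_*(v ⊗ 1)`**: the action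
preserves rational classes and shifts types by `(r, r)` (the seat's g30-#14), which is the carrier description of a morphism into the Tate twist (the tree's `HodgeModel.exists_hom_of_typeShift`).
[cite: VoisinHodgeI2002, §7.3.1 Def. 7.22, §11.3.3 Lemma 11.41 and p. 286] [cite: DeligneHodgeII1971, 2.1.13–2.1.14] -/
theorem BettiUniverse.exists_hom_tateTwist_of_mem_hodgeClasses_kunnethSummand (hHD : exists_isReal_hodgeModel) (hY : IsSmoothProjective m Y) (hZ : IsSmoothProjective n Z) {c i j a r : ℕ}
    (hij : i + j = 2 * c) (hab : a + 2 * c = i + 2 * n) (hr : n + r = c) (hw : ((i : ℕ) : ℤ) - 2 * (r : ℤ) = ((a : ℕ) : ℤ)) {t : bettiCohomology Y i ⊗[ℚ] bettiCohomology Z j}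
    (ht : t ∈ (BettiUniverse.kunnethSummand hHD hY hZ (2 * c) ⟨(i, j), mem_antidiagonal.2 hij⟩).hodgeClasses c) :
    ∃ φ : HodgeStructure.Hom (BettiUniverse.hodge hHD hZ a) (((BettiUniverse.hodge hHD hY i).tateTwist (r : ℤ)).cast hw),
      ∀ v, ofRatClass (ComplexPoints Y) i (φ.toLinearMap v) =
        corrAction complexOrientationFamily hY hZ hab (ofRatClass (ComplexPoints (Y ⊗ Z)) (2 * c) (BettiUniverse.crossMap Y Z hij t)) (ofRatClass (ComplexPoints Z) a v) := by
  have hI := hodgePQ_independent_of_hodgeModel_holds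
  obtain ⟨hR, hS, -⟩ := BettiUniverse.typeShift_corrAction_crossMap_of_mem_hodgeClasses hHD hY hZ hij hab ht
  set f := corrAction complexOrientationFamily hY hZ hab (ofRatClass (ComplexPoints (Y ⊗ Z)) (2 * c) (BettiUniverse.crossMap Y Z hij t)) with hf
  have hfH : ∀ (p q : ℕ), p + q = a → ∀ u, (BettiUniverse.realHodgeModel hHD hZ).pullback a u ∈ (BettiUniverse.realHodgeModel hHD hZ).hodgePQ a p q →
      (BettiUniverse.realHodgeModel hHD hY).pullback i (f u) ∈ (BettiUniverse.realHodgeModel hHD hY).hodgePQ i (p + r) (q + r) := by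
    intro p q _ u hu
    obtain ⟨A', hA'⟩ := hS p q u ⟨_, hu⟩ (p + r) (q + r) (by omega) (by omega)
    exact hI m Y hY A' _ i (p + r) (q + r) _ hA'
  obtain ⟨φ, hφ⟩ := HodgeModel.exists_hom_of_typeShift hZ hY (BettiUniverse.realHodgeModel hHD hZ) (BettiUniverse.realHodgeModel_isHodgeSymmetric hHD hZ)
    (BettiUniverse.realHodgeModel hHD hY) (BettiUniverse.realHodgeModel_isHodgeSymmetric hHD hY) (show a + 2 * r = i by omega)
    (((BettiUniverse.hodge hHD hY i).tateTwist (r : ℤ)).cast hw)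
    (HodgeModel.piece_tateTwist_cast hY (BettiUniverse.realHodgeModel hHD hY) (BettiUniverse.realHodgeModel_isHodgeSymmetric hHD hY) hw) f hR hfH
  refine ⟨φ, fun v ↦ ?_⟩
  have h := hφ (1 ⊗ₜ v)
  rwa [LinearMap.baseChange_tmul, ofRatClassBaseChange_tmul, ofRatClassBaseChange_tmul, one_smul, one_smul] at h

/-- **… and `φ_t` is unique** (a morphism of Hodge structures is its `ℚ`-linear map; `⊗ 1` is injective). [cite: DeligneHodgeII1971, Thm. 2.3.5] [cite: VoisinHodgeI2002, §7.1.1] -/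
theorem BettiUniverse.existsUnique_hom_tateTwist_of_mem_hodgeClasses_kunnethSummand (hHD : exists_isReal_hodgeModel) (hY : IsSmoothProjective m Y) (hZ : IsSmoothProjective n Z) {c i j a r : ℕ}
    (hij : i + j = 2 * c) (hab : a + 2 * c = i + 2 * n) (hr : n + r = c) (hw : ((i : ℕ) : ℤ) - 2 * (r : ℤ) = ((a : ℕ) : ℤ)) {t : bettiCohomology Y i ⊗[ℚ] bettiCohomology Z j}
    (ht : t ∈ (BettiUniverse.kunnethSummand hHD hY hZ (2 * c) ⟨(i, j), mem_antidiagonal.2 hij⟩).hodgeClasses c) :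
    ∃! φ : HodgeStructure.Hom (BettiUniverse.hodge hHD hZ a) (((BettiUniverse.hodge hHD hY i).tateTwist (r : ℤ)).cast hw),
      ∀ v, ofRatClass (ComplexPoints Y) i (φ.toLinearMap v) =
        corrAction complexOrientationFamily hY hZ hab (ofRatClass (ComplexPoints (Y ⊗ Z)) (2 * c) (BettiUniverse.crossMap Y Z hij t)) (ofRatClass (ComplexPoints Z) a v) := by
  obtain ⟨φ, hφ⟩ := BettiUniverse.exists_hom_tateTwist_of_mem_hodgeClasses_kunnethSummand hHD hY hZ hij hab hr hw ht
  refine ⟨φ, hφ, fun ψ hψ ↦ HodgeStructure.Hom.toLinearMap_injective (LinearMap.ext fun v ↦ ofRatClass_injective (Y := ComplexPoints Y) i ?_)⟩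
  change ofRatClass (ComplexPoints Y) i (ψ.toLinearMap v) = ofRatClass (ComplexPoints Y) i (φ.toLinearMap v)
  rw [hψ v, hφ v]

/-! ### §2 From a morphism of Hodge structures to the Hodge class -/

/-- **Every morphism of Hodge structures `φ : Hᵃ(Z) → Hⁱ(Y)(r)` (`i = a + 2r`, `i + j = 2c`, `a + j = 2n`) is `φ_t` for a Hodge class `t` of `Hⁱ(Y;ℚ) ⊗ Hʲ(Z;ℚ)`: `(crossMap t ⊗ 1)_*(v ⊗ 1) = φ(v) ⊗ 1`**
(the tree's `HodgeModel.exists_carrier_of_hom` gives the carrier map — rational, of bidegree `(r, r)` — and the seat's g30-#14 the Hodge class). [cite: VoisinHodgeI2002, §7.3.1 Def. 7.22, §11.3.3 Lemma 11.41 and p. 286]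
[cite: DeligneHodgeII1971, 2.1.13–2.1.14] -/
theorem BettiUniverse.exists_mem_hodgeClasses_corrAction_crossMap_eq_ofRatClass_hom (hHD : exists_isReal_hodgeModel) (hY : IsSmoothProjective m Y) (hZ : IsSmoothProjective n Z) {c i j a r : ℕ}
    (hij : i + j = 2 * c) (haj : a + j = 2 * n) (hab : a + 2 * c = i + 2 * n) (hr : n + r = c) (hw : ((i : ℕ) : ℤ) - 2 * (r : ℤ) = ((a : ℕ) : ℤ))
    (φ : HodgeStructure.Hom (BettiUniverse.hodge hHD hZ a) (((BettiUniverse.hodge hHD hY i).tateTwist (r : ℤ)).cast hw)) :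
    ∃ t ∈ (BettiUniverse.kunnethSummand hHD hY hZ (2 * c) ⟨(i, j), mem_antidiagonal.2 hij⟩).hodgeClasses c,
      ∀ v, corrAction complexOrientationFamily hY hZ hab (ofRatClass (ComplexPoints (Y ⊗ Z)) (2 * c) (BettiUniverse.crossMap Y Z hij t)) (ofRatClass (ComplexPoints Z) a v) =
        ofRatClass (ComplexPoints Y) i (φ.toLinearMap v) := by
  have hI := hodgePQ_independent_of_hodgeModel_holds
  obtain ⟨f, hfφ, hR, hSm⟩ := HodgeModel.exists_carrier_of_hom hZ hY (BettiUniverse.realHodgeModel hHD hZ) (BettiUniverse.realHodgeModel_isHodgeSymmetric hHD hZ)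
    (BettiUniverse.realHodgeModel hHD hY) (BettiUniverse.realHodgeModel_isHodgeSymmetric hHD hY) (show a + 2 * r = i by omega)
    (((BettiUniverse.hodge hHD hY i).tateTwist (r : ℤ)).cast hw)
    (HodgeModel.piece_tateTwist_cast hY (BettiUniverse.realHodgeModel hHD hY) (BettiUniverse.realHodgeModel_isHodgeSymmetric hHD hY) hw) φ
  -- the carrier map is type-shifting in the sense of g30-#14
  have hS : ∀ (p q : ℕ), p + q = a → ∀ u : complexBetti Z a, IsOfHodgeType n Z a p q u → ∀ p' q' : ℕ, p' + n = p + c → q' + n = q + c → IsOfHodgeType m Y i p' q' (f u) := by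
    intro p q hpq u hu p' q' hp hq
    obtain ⟨A', hA'⟩ := hu
    have h := hSm p q hpq u (hI n Z hZ A' _ a p q u hA')
    rw [show p' = p + r by omega, show q' = q + r by omega]
    exact ⟨_, h⟩
  have hV : ∀ (p q : ℕ), p + q = a → ∀ u : complexBetti Z a, IsOfHodgeType n Z a p q u → p + c < n ∨ q + c < n → f u = 0 := fun p q _ u _ h ↦ by omega
  obtain ⟨t, ht, htf⟩ := BettiUniverse.exists_mem_hodgeClasses_corrAction_crossMap_eq_of_typeShift hHD hY hZ hij haj hab f hR hS hV
  refine ⟨t, ht, fun v ↦ ?_⟩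
  have h := hfφ (1 ⊗ₜ v)
  rw [LinearMap.baseChange_tmul, ofRatClassBaseChange_tmul, ofRatClassBaseChange_tmul, one_smul, one_smul] at h
  rw [htf, h]

/-- **… and the Hodge class `t` is unique** (g30-#2: a class of the summand is determined by its action; the rational classes span). [cite: VoisinHodgeI2002, §7.1.1, §11.3.3 Lemma 11.41 and p. 286] -/
theorem BettiUniverse.existsUnique_mem_hodgeClasses_corrAction_crossMap_eq_ofRatClass_hom (hHD : exists_isReal_hodgeModel) (hY : IsSmoothProjective m Y) (hZ : IsSmoothProjective n Z)
    {c i j a r : ℕ} (hij : i + j = 2 * c) (haj : a + j = 2 * n) (hab : a + 2 * c = i + 2 * n) (hr : n + r = c) (hw : ((i : ℕ) : ℤ) - 2 * (r : ℤ) = ((a : ℕ) : ℤ))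
    (φ : HodgeStructure.Hom (BettiUniverse.hodge hHD hZ a) (((BettiUniverse.hodge hHD hY i).tateTwist (r : ℤ)).cast hw)) :
    ∃! t, t ∈ (BettiUniverse.kunnethSummand hHD hY hZ (2 * c) ⟨(i, j), mem_antidiagonal.2 hij⟩).hodgeClasses c ∧
      ∀ v, corrAction complexOrientationFamily hY hZ hab (ofRatClass (ComplexPoints (Y ⊗ Z)) (2 * c) (BettiUniverse.crossMap Y Z hij t)) (ofRatClass (ComplexPoints Z) a v) =
        ofRatClass (ComplexPoints Y) i (φ.toLinearMap v) := by
  obtain ⟨t, ht, htφ⟩ := BettiUniverse.exists_mem_hodgeClasses_corrAction_crossMap_eq_ofRatClass_hom hHD hY hZ hij haj hab hr hw φ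
  refine ⟨t, ⟨ht, htφ⟩, fun t' ht' ↦ BettiUniverse.corrAction_crossMap_injective complexOrientationFamily hY hZ hij haj hab ?_⟩
  refine LinearMap.ext_on_range (BettiUniverse.span_range_ofRatClass_eq_top hZ a) fun v ↦ ?_
  rw [ht'.2 v, htφ v]

/-! ### §3 The dimension identity and the duality -/

/-- **`dim_ℚ Hdgᶜ(Hⁱ(Y) ⊗ Hʲ(Z)) = dim_ℚ Hom_HS(Hᵃ(Z), Hⁱ(Y)(r))`** for `i + j = 2c`, `a + j = 2n`, `c = n + r`: `t ↦ φ_t` (§1) is ℚ-linear, injective (g30-#2) and surjective (§2).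
[cite: VoisinHodgeI2002, §11.3.3 Thm. 11.38–11.40, Lemma 11.41 and pp. 285–287] [cite: DeligneHodgeII1971, 2.1.13–2.1.14] -/
theorem BettiUniverse.finrank_hodgeClasses_kunnethSummand_eq_finrank_hom_tateTwist_target (hHD : exists_isReal_hodgeModel) (hY : IsSmoothProjective m Y) (hZ : IsSmoothProjective n Z) {c i j a r : ℕ}
    (hij : i + j = 2 * c) (haj : a + j = 2 * n) (hab : a + 2 * c = i + 2 * n) (hr : n + r = c) (hw : ((i : ℕ) : ℤ) - 2 * (r : ℤ) = ((a : ℕ) : ℤ)) :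
    Module.finrank ℚ ↥((BettiUniverse.kunnethSummand hHD hY hZ (2 * c) ⟨(i, j), mem_antidiagonal.2 hij⟩).hodgeClasses c) =
      Module.finrank ℚ (HodgeStructure.Hom (BettiUniverse.hodge hHD hZ a) (((BettiUniverse.hodge hHD hY i).tateTwist (r : ℤ)).cast hw)) := by
  classical
  -- the map `t ↦ φ_t`
  choose Φ₀ hΦ₀ using fun t : ↥((BettiUniverse.kunnethSummand hHD hY hZ (2 * c) ⟨(i, j), mem_antidiagonal.2 hij⟩).hodgeClasses c) ↦
    BettiUniverse.exists_hom_tateTwist_of_mem_hodgeClasses_kunnethSummand hHD hY hZ hij hab hr hw t.2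
  have hext : ∀ (ψ ψ' : HodgeStructure.Hom (BettiUniverse.hodge hHD hZ a) (((BettiUniverse.hodge hHD hY i).tateTwist (r : ℤ)).cast hw)),
      (∀ v, ofRatClass (ComplexPoints Y) i (ψ.toLinearMap v) = ofRatClass (ComplexPoints Y) i (ψ'.toLinearMap v)) → ψ = ψ' :=
    fun ψ ψ' h ↦ HodgeStructure.Hom.toLinearMap_injective (LinearMap.ext fun v ↦ ofRatClass_injective (Y := ComplexPoints Y) i (h v))
  let Φ : ↥((BettiUniverse.kunnethSummand hHD hY hZ (2 * c) ⟨(i, j), mem_antidiagonal.2 hij⟩).hodgeClasses c) →ₗ[ℚ]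
      HodgeStructure.Hom (BettiUniverse.hodge hHD hZ a) (((BettiUniverse.hodge hHD hY i).tateTwist (r : ℤ)).cast hw) :=
    { toFun := Φ₀
      map_add' := fun t t' ↦ hext _ _ fun v ↦ by
        change ofRatClass (ComplexPoints Y) i ((Φ₀ (t + t')).toLinearMap v) = ofRatClass (ComplexPoints Y) i ((Φ₀ t).toLinearMap v + (Φ₀ t').toLinearMap v)
        rw [map_add, hΦ₀, hΦ₀, hΦ₀, Submodule.coe_add, map_add, map_add, map_add, LinearMap.add_apply]
      map_smul' := fun q t ↦ hext _ _ fun v ↦ by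
        change ofRatClass (ComplexPoints Y) i ((Φ₀ (q • t)).toLinearMap v) = ofRatClass (ComplexPoints Y) i (q • (Φ₀ t).toLinearMap v)
        rw [hΦ₀, Submodule.coe_smul, map_smul, ofRatClass_smul, map_smul, LinearMap.smul_apply, ofRatClass_smul, hΦ₀] }
  have hΦ : ∀ t, Φ t = Φ₀ t := fun _ ↦ rfl
  refine (LinearEquiv.ofBijective Φ ⟨?_, fun φ ↦ ?_⟩).finrank_eq
  · rw [← LinearMap.ker_eq_bot, LinearMap.ker_eq_bot']
    intro t ht
    apply Subtype.ext
    refine BettiUniverse.eq_zero_of_corrAction_crossMap_eq_zero complexOrientationFamily hY hZ hij haj hab ?_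
    refine LinearMap.ext_on_range (BettiUniverse.span_range_ofRatClass_eq_top hZ a) fun v ↦ ?_
    rw [← hΦ₀ t v, ← hΦ t, ht]
    change ofRatClass (ComplexPoints Y) i 0 = 0
    rw [map_zero]
  · obtain ⟨t, ht, htφ⟩ := BettiUniverse.exists_mem_hodgeClasses_corrAction_crossMap_eq_ofRatClass_hom hHD hY hZ hij haj hab hr hw φ
    exact ⟨⟨t, ht⟩, hext _ _ fun v ↦ by rw [hΦ, hΦ₀, htφ v]⟩

/-- **Duality: `dim_ℚ Hom_HS(Hⁱ(Y), Hʲ(Z)(s)) = dim_ℚ Hom_HS(Hᵃ(Z), Hⁱ(Y)(r))`** for `i + j = 2c`, `a + j = 2n`, `c = n + r`, `j − 2s = i` — both are the number of Hodge classes of `Hⁱ(Y) ⊗ Hʲ(Z)` (the tree's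
`finrank_hodgeClasses_tensor_hodge_eq_finrank_hom_tateTwist` and §3), i.e. `Hom_HS(HⁱY, HʲZ(s)) ≅ Hom_HS((HʲZ)^∨(−n−s…), …)`: Poincaré duality `Hʲ(Z) ≅ H^{2n−j}(Z)^∨(−n)` read through Lemma 11.41.
[cite: VoisinHodgeI2002, §11.3.3 Thm. 11.38–11.40, Lemma 11.41 and pp. 285–287] [cite: HatcherAT2002, §3.3 Prop. 3.38] -/
theorem BettiUniverse.finrank_hom_tateTwist_eq_finrank_hom_tateTwist_swap (hHD : exists_isReal_hodgeModel) (hY : IsSmoothProjective m Y) (hZ : IsSmoothProjective n Z) {c i j a r : ℕ} {s : ℤ}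
    (hij : i + j = 2 * c) (haj : a + j = 2 * n) (hab : a + 2 * c = i + 2 * n) (hr : n + r = c) (hw : ((i : ℕ) : ℤ) - 2 * (r : ℤ) = ((a : ℕ) : ℤ)) (hs : ((j : ℕ) : ℤ) - 2 * s = ((i : ℕ) : ℤ)) :
    Module.finrank ℚ (HodgeStructure.Hom (BettiUniverse.hodge hHD hY i) (((BettiUniverse.hodge hHD hZ j).tateTwist s).cast hs)) =
      Module.finrank ℚ (HodgeStructure.Hom (BettiUniverse.hodge hHD hZ a) (((BettiUniverse.hodge hHD hY i).tateTwist (r : ℤ)).cast hw)) := by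
  have e := BettiUniverse.finrank_hodgeClasses_tensor_hodge_eq_finrank_hom_tateTwist hHD hY hZ i j (s := s) hs
  rw [show ((i : ℕ) : ℤ) + s = ((c : ℕ) : ℤ) by omega] at e
  rw [← e, ← BettiUniverse.finrank_hodgeClasses_kunnethSummand_eq_finrank_hom_tateTwist_target hHD hY hZ hij haj hab hr hw]
  rfl

end Literature.AlgebraicGeometry.HodgeTheory

end
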